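import Literature.AlgebraicGeometry.Resolution.ResolutionOfSingularities
import Literature.AlgebraicGeometry.Morphisms.RefinedValuativeCriterionDense
import Mathlib.AlgebraicGeometry.Morphisms.ClosedImmersion
import Mathlib.AlgebraicGeometry.Morphisms.Separated
import Mathlib.AlgebraicGeometry.Morphisms.FiniteType
import Mathlib.AlgebraicGeometry.Morphisms.QuasiCompact
import Mathlib.FieldTheory.Perfect
import HarnessLib

/-!
# `WeightedInvariant.DescentPerfectToAll`, line `root-of-a-constant`: resolution at the perfect base

Route `ResolutionOfSingularities/WeightedInvariant`, crux `DescentPerfectToAll`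
(stmt-ResolutionOfSingularities-0549), stub `stub_perfectBaseResolution` of the lead's skeleton
`work/DescentPerfectToAll.lean`, PROVED here (statement verbatim from the ledger registration).

**Statement.** Fix a prime `p` and assume resolution of singularities for reduced separated
schemes of finite type over every *perfect* field of characteristic `p`. Let `k ⊆ Ω` be fields of
characteristic `p` with `Ω` perfect and `f : X → Spec k` separated of finite type. Then there is a
closed immersion `ι : W ↪ X ×_k Ω` which is surjective, with `W` reduced, such that `W` admits a
resolution of singularities.

**Proof.** Take `W := (X ×_k Ω)_red`, the closed subscheme cut out by the nilradical ideal sheaf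
(Mathlib `Scheme.nilradical`, `Scheme.IdealSheafData.subscheme`), and `ι` its inclusion
`subschemeι`, a closed immersion (Mathlib instance) which is surjective with reduced source
(in-tree instances `surjective_subschemeι_nilradical`, `isReduced_subscheme_nilradical`). The
structure morphism `ι ≫ pr₂ : W → X ×_k Ω → Spec Ω` is separated, locally of finite type and
quasi-compact: `ι` is a closed immersion (hence affine, finite), and `pr₂` is a base change of
`f`. So the hypothesis, applied to the perfect field `Ω` and the reduced `Ω`-scheme `W`, resolves
`W`.
-/

-- single-problem summit: the doubled namespace component `ResolutionOfSingularities` is forced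
set_option linter.dupNamespace false -- mandated namespace of this single-conjunct summit

noncomputable section

open CategoryTheory CategoryTheory.Limits AlgebraicGeometry
open Literature.AlgebraicGeometry.Resolution

namespace Summit.ResolutionOfSingularities.ResolutionOfSingularities.Theorems

universe u

/-- **The reduction of a scheme of finite type over a field is resolved by any resolution
hypothesis for reduced schemes over that field.** For `g : V ⟶ Spec K` separated, locally of
finite type and quasi-compact, the reduction `V_red = V(nil 𝒪_V)` is a reduced closed subscheme
with surjective inclusion, and its structure morphism `V_red ↪ V → Spec K` is again separated,
locally of finite type and quasi-compact; hence any statement resolving all such reduced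
`K`-schemes resolves `V_red`. [folklore] -/
theorem hasResolution_nilradical_subscheme {K : Type u} [Field K] {V : Scheme.{u}}
    (g : V ⟶ Spec (.of K)) [IsSeparated g] [LocallyOfFiniteType g] [QuasiCompact g]
    (H : ∀ (Z : Scheme.{u}) (h : Z ⟶ Spec (.of K)), IsSeparated h → LocallyOfFiniteType h →
      QuasiCompact h → IsReduced Z → Scheme.HasResolution Z) :
    Scheme.HasResolution V.nilradical.subscheme :=
  H V.nilradical.subscheme (V.nilradical.subschemeι ≫ g) inferInstance inferInstance inferInstance
    inferInstance

/-- STUB `stub_perfectBaseResolution` (antecedent consumer at the perfect base): assuming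
resolution of singularities for reduced separated schemes of finite type over every perfect field
of characteristic `p`, for fields `k ⊆ Ω` of characteristic `p` with `Ω` perfect and a separated
finite-type `f : X → Spec k`, the reduction `W = (X ×_k Ω)_red ↪ X ×_k Ω` is a surjective closed
immersion from a reduced scheme, and `W` admits a resolution of singularities (the hypothesis
applied to the separated finite-type `Ω`-scheme `W → X ×_k Ω → Spec Ω`). [folklore] -/
theorem stub_perfectBaseResolution : ∀ (p : ℕ) [Fact p.Prime], (∀ (κ : Type) [Field κ] [CharP κ p] [PerfectField κ] (Z : Scheme.{0}) (h : Z ⟶ Spec (.of κ)), IsSeparated h → LocallyOfFiniteType h → QuasiCompact h → IsReduced Z → Scheme.HasResolution Z) → ∀ (k Ω : Type) [Field k] [CharP k p] [Field Ω] [Algebra k Ω] [CharP Ω p] [PerfectField Ω] (X : Scheme.{0}) (f : X ⟶ Spec (.of k)), IsSeparated f → LocallyOfFiniteType f → QuasiCompact f → ∃ (W : Scheme.{0}) (ι : W ⟶ pullback f (Spec.map (CommRingCat.ofHom (algebraMap k Ω)))), IsClosedImmersion ι ∧ Surjective ι ∧ IsReduced W ∧ Scheme.HasResolution W := by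
  intro p _ H k Ω _ _ _ _ _ _ X f _ _ _
  -- `W := (X ×_k Ω)_red` with its closed immersion `ι : W ↪ X ×_k Ω`
  refine ⟨(pullback f (Spec.map (CommRingCat.ofHom (algebraMap k Ω)))).nilradical.subscheme,
    (pullback f (Spec.map (CommRingCat.ofHom (algebraMap k Ω)))).nilradical.subschemeι,
    inferInstance, inferInstance, inferInstance, ?_⟩
  -- the structure morphism `pr₂ : X ×_k Ω → Spec Ω` is a base change of `f`
  exact hasResolution_nilradical_subscheme
    (pullback.snd f (Spec.map (CommRingCat.ofHom (algebraMap k Ω)))) (H Ω)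

end Summit.ResolutionOfSingularities.ResolutionOfSingularities.Theorems

end
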